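import Mathlib.MeasureTheory.Measure.Haar.Disintegration
import Mathlib.MeasureTheory.Integral.Prod

/-!
# `Summit.QuantumFields.Balaban3D.Proofs.LinearDisintegration` — item F6 of HOME/drafts/p4/FIBRE49.md: DISINTEGRATION OF LEBESGUE
# (additive Haar) MEASURE ALONG A SURJECTIVE LINEAR MAP with a chosen linear right inverse — the honest content of the δ-function
# identity «δ(Q̄A)δ_{Ax}(A) dA = Z · d(A↾subspace)» of [Balaban1985UV3] (21) p. 261 (the linear constraint after (17) flattens `Q(A′) = 0`
# to `Q̄A = 0`): `∫ f dμ_E = c · ∫_F ∫_{ker L} f(κ + s(v)) dκ dv` with an (unspecified, positive, finite) constant `c` — lane `pub-balaban3d`,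
# seat p4 (generic tool for the discharge of the residuals R3D-01/02)

HONEST FRAMING (lane PLAN.md §0, binding): see `…Proofs.SectAFirstStep`.  [folklore] measure theory, Mathlib-only: the construction of
Mathlib's `LinearMap.exists_map_addHaar_eq_smul_addHaar` (Haar uniqueness + `ContinuousLinearEquiv.isAddHaarMeasure_map`) re-run with an
EXPLICIT complement (the range of the right inverse `s`) so that the FIBRE INTEGRAL `v ↦ ∫ f(κ + s v) dκ` appears.  The constant `c` is the
`addHaarScalarFactor` of the two Haar measures; making it explicit (print's «Z») for the lane's normalisations is left to the consumer.

WHAT THIS FILE PROVES (no `sorry`, axioms standard): `fibreEquiv L s hs : (ker L × F) ≃L[ℝ] E` (`(κ, v) ↦ κ + s v`), `fibreEquiv_apply`,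
`exists_eq_smul_map_fibreEquiv` (`μ = c • ((addHaar on ker L) ⊗ ν).map fibreEquiv`, `0 < c < ∞`), **`exists_integral_eq_fibre`**
(`∃ c, … ∀ f integrable, ∫ f dμ = c.toReal · ∫ v, ∫ κ, f(κ + s v) dκ dν`).
-/

noncomputable section

namespace Summit.QuantumFields.Balaban3D.Proofs.LinearDisintegration

open MeasureTheory Measure
open scoped ENNReal

variable {E F : Type*} [NormedAddCommGroup E] [NormedSpace ℝ E] [FiniteDimensional ℝ E] [MeasurableSpace E] [BorelSpace E]
  [NormedAddCommGroup F] [NormedSpace ℝ F] [FiniteDimensional ℝ F] [MeasurableSpace F] [BorelSpace F]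
  (L : E →ₗ[ℝ] F) (s : F →ₗ[ℝ] E)

section
variable (hs : L.comp s = LinearMap.id)

omit [MeasurableSpace E] [BorelSpace E] [MeasurableSpace F] [BorelSpace F] in
/-- THE FIBRE PARAMETRISATION of a linear map `L` with linear right inverse `s` (`L ∘ s = id`): `(κ, v) ↦ κ + s(v)` is a continuous linear
equivalence `ker L × F ≃ E` (inverse `x ↦ (x − s(Lx), Lx)`); the fibre `L⁻¹(v)` is `ker L + s(v)`. [folklore] -/
def fibreEquiv : (LinearMap.ker L × F) ≃L[ℝ] E :=
  LinearEquiv.toContinuousLinearEquiv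
    { toFun := fun p => (p.1 : E) + s p.2
      invFun := fun x => (⟨x - s (L x), by
          rw [LinearMap.mem_ker, map_sub]
          have h := LinearMap.congr_fun hs (L x)
          simp only [LinearMap.comp_apply, LinearMap.id_apply] at h
          rw [h, sub_self]⟩, L x)
      map_add' := fun p q => by
        simp only [Prod.fst_add, Prod.snd_add, Submodule.coe_add, map_add]; abel
      map_smul' := fun c p => by
        simp only [Prod.smul_fst, Prod.smul_snd, Submodule.coe_smul, map_smul, RingHom.id_apply, smul_add]
      left_inv := fun p => by
        obtain ⟨⟨κ, hκ⟩, v⟩ := p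
        have hLκ : L κ = 0 := hκ
        have h := LinearMap.congr_fun hs v
        simp only [LinearMap.comp_apply, LinearMap.id_apply] at h
        ext
        · simp [map_add, hLκ, h]
        · simp [map_add, hLκ, h]
      right_inv := fun x => by simp }

omit [MeasurableSpace E] [BorelSpace E] [MeasurableSpace F] [BorelSpace F] in
/-- `fibreEquiv L s hs (κ, v) = κ + s v` (unfolding lemma). [folklore] -/
@[simp] theorem fibreEquiv_apply (p : LinearMap.ker L × F) : fibreEquiv L s hs p = (p.1 : E) + s p.2 := rfl

variable (μ : Measure E) [μ.IsAddHaarMeasure] (ν : Measure F) [ν.IsAddHaarMeasure]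

include hs in
/-- **The additive Haar measure of `E` IS, up to a positive finite constant, the push-forward of `(Haar on ker L) ⊗ ν` under the fibre
parametrisation** (Haar uniqueness: the push-forward of a Haar measure under a continuous linear equivalence is a Haar measure). [folklore] -/
theorem exists_eq_smul_map_fibreEquiv :
    ∃ c : ℝ≥0∞, c ≠ 0 ∧ c ≠ ∞ ∧
      μ = c • ((addHaar : Measure (LinearMap.ker L)).prod ν).map (fibreEquiv L s hs) := by
  set e := fibreEquiv L s hs with he
  have : IsAddHaarMeasure (((addHaar : Measure (LinearMap.ker L)).prod ν).map e) :=
    e.isAddHaarMeasure_map _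
  refine ⟨addHaarScalarFactor μ (((addHaar : Measure (LinearMap.ker L)).prod ν).map e), ?_, ENNReal.coe_ne_top,
    isAddLeftInvariant_eq_smul _ _⟩
  simpa only [ne_eq, ENNReal.coe_eq_zero] using
    (addHaarScalarFactor_pos_of_isAddHaarMeasure μ (((addHaar : Measure (LinearMap.ker L)).prod ν).map e)).ne'

end

variable (μ : Measure E) [μ.IsAddHaarMeasure] (ν : Measure F) [ν.IsAddHaarMeasure]

/-- **DISINTEGRATION OF THE HAAR INTEGRAL ALONG `L`** ((21) p. 261 «δ(Q̄A)δ_{Ax}(A)»-calculus made honest): there is a constant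
`0 < c < ∞` such that for every `μ`-integrable `f`, `∫ f dμ = c · ∫_F (∫_{ker L} f(κ + s v) dκ) dν(v)` — the inner integral is the
integral over the FIBRE `L⁻¹(v)` with the Haar measure of `ker L` transported by the translation `s(v)`. [cite: Balaban1985UV3, (21) p.261] -/
theorem exists_integral_eq_fibre (hs : L.comp s = LinearMap.id) :
    ∃ c : ℝ≥0∞, c ≠ 0 ∧ c ≠ ∞ ∧ ∀ {G : Type*} [NormedAddCommGroup G] [NormedSpace ℝ G] (f : E → G), Integrable f μ →
      ∫ x, f x ∂μ = c.toReal • ∫ v, ∫ κ : LinearMap.ker L, f ((κ : E) + s v) ∂(addHaar : Measure (LinearMap.ker L)) ∂ν := by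
  obtain ⟨c, c_pos, c_fin, hμ⟩ := exists_eq_smul_map_fibreEquiv L s hs μ ν
  refine ⟨c, c_pos, c_fin, fun {G} _ _ f hf => ?_⟩
  set e := fibreEquiv L s hs with he
  -- integrability of `f ∘ e` for the product measure
  have hf' : Integrable f (c • ((addHaar : Measure (LinearMap.ker L)).prod ν).map e) := by rw [← hμ]; exact hf
  have hf'' : Integrable f (((addHaar : Measure (LinearMap.ker L)).prod ν).map e) :=
    (integrable_smul_measure c_pos c_fin).mp hf'
  have hfe : Integrable (fun p : LinearMap.ker L × F => f (e p)) ((addHaar : Measure (LinearMap.ker L)).prod ν) := by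
    have := (integrable_map_equiv e.toHomeomorph.toMeasurableEquiv f).mp hf''
    exact this
  calc ∫ x, f x ∂μ = ∫ x, f x ∂(c • ((addHaar : Measure (LinearMap.ker L)).prod ν).map e) := by rw [← hμ]
    _ = c.toReal • ∫ x, f x ∂(((addHaar : Measure (LinearMap.ker L)).prod ν).map e) := integral_smul_measure f c
    _ = c.toReal • ∫ p, f (e p) ∂((addHaar : Measure (LinearMap.ker L)).prod ν) := by
        congr 1; exact integral_map_equiv e.toHomeomorph.toMeasurableEquiv f
    _ = c.toReal • ∫ v, ∫ κ : LinearMap.ker L, f ((κ : E) + s v) ∂(addHaar : Measure (LinearMap.ker L)) ∂ν := by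
        rw [integral_prod_symm _ hfe]
        rfl

end Summit.QuantumFields.Balaban3D.Proofs.LinearDisintegration

end
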